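import Literature.NumberTheory.Transcendental.PkappaThetaCosetHilbert
import Literature.NumberTheory.Transcendental.ThetaLinealityStructure
import HarnessLib

/-!
# The fibre family: characters times shifted vector monomials on a product of torus and vector directions

Topic: `Literature/NumberTheory/Transcendental`. A brick of the discharge of the named fact
`Literature.NumberTheory.Transcendental.philippon1986_std` (classification of the obstruction
subgroups of Philippon's zero estimate on `M_κ = 𝔾ₘ^β × P_κ`, general number of elliptic factors;
the fibre count bounding the abelian rank of an obstruction subgroup). Fix a chart `M₀` and free
coordinate sets `F_y ⊆ β`, `F_s ⊆ δ`. To `μ ∈ ℕ^{F_y ⊔ F_s}` with `|μ| ≤ t` we attach the theta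
monomial of degree `t`

  `R_μ = ∏_{j ∈ F_y} X_{(j,(M₀,none))}^{μ_j} · ∏_{e ∈ F_s} X_{(none,(M₀,e))}^{μ_e} · X_{(none,(M₀,none))}^{t-|μ|}`.

* `thetaEval_fibForm_add` — the FACTORISATION along translates with vanishing `E`-coordinates:
  at `x + (y, 0, s)` with `Θ₀(x) = Θ_{(M₀,none)}(x) ≠ 0`,
  `F_{R_μ}(x + (y,0,s)) = Θ₀(x)^t · ∏_j e^{μ_j x_j} · fibFun ν(x) μ y s` with
  `fibFun ν μ y s = ∏_j e^{μ_j y_j} · ∏_e (ν_e + s_e)^{μ_e}` and `ν_e(x) = Θ_{(M₀,e)}(x)/Θ₀(x)`;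
* `fibFun_linearIndependent` — for subspaces `Y ≤ ℂ^β`, `S ≤ ℂ^δ` on which the coordinates `F_y`,
  `F_s` restrict bijectively, the functions `(y, s) ↦ fibFun ν μ y s`, `|μ| ≤ t`, on `Y × S` are
  linearly independent for every `ν` (Dedekind–Artin independence of the characters `e^{⟨a,y⟩}` of
  `ℂ^{F_y}`, then the shifted monomials `∏ (ν_e + s_e)^{b_e}` are the images of the monomials under
  the automorphism `s ↦ s + ν` of `ℂ[s]`).

Everything is PROVED; the only definitions are `fibIdx`, `fibVar`, `fibJ₀`, `fibExpo`, `fibForm`,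
`fibFun`, `fibChar`.

## References

* Yu. V. Nesterenko, P. Philippon (eds.), *Introduction to Algebraic Independence Theory*,
  LNM 1752, Springer 2001, Ch. 11 (D. Roy), Prop. 2.3. [NesterenkoPhilippon2001]
* E. Artin, *Galois Theory*, Notre Dame 1944, Thm. 12 (independence of characters). [folklore]
-/

noncomputable section

open Complex MvPolynomial Module
open scoped PeriodPair

namespace Literature.NumberTheory.Transcendental

namespace GaGmE

namespace Std

variable {β γ δ : Type} [Fintype β] [Fintype γ] [Fintype δ] [DecidableEq γ]
variable (L : PeriodPair) (κM : δ → γ → Kbar)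
variable (M₀ : γ → Fin 3) (Fy : Finset β) (Fs : Finset δ)

/-! ### The forms -/

/-- The index type `F_y ⊔ F_s` of the free torus and vector coordinates. [folklore] -/
abbrev fibIdx (Fy : Finset β) (Fs : Finset δ) : Type := ↥Fy ⊕ ↥Fs

/-- The theta index of a free coordinate: `(j, (M₀, none))` resp. `(none, (M₀, e))`. [folklore] -/
def fibVar : fibIdx Fy Fs → Option β × ThetaIdx γ δ
  | Sum.inl j => (some j.1, (M₀, none))
  | Sum.inr e => (none, (M₀, some e.1))

/-- The homogenising variable `(none, (M₀, none))`. [folklore] -/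
def fibJ₀ : Option β × ThetaIdx γ δ := (none, (M₀, none))

/-- The exponent of the fibre monomial attached to `μ`, `|μ| ≤ t`. [folklore] -/
def fibExpo (t : ℕ) (μ : fibIdx Fy Fs →₀ ℕ) : (Option β × ThetaIdx γ δ) →₀ ℕ :=
  μ.mapDomain (fibVar M₀ Fy Fs) + Finsupp.single (fibJ₀ (β := β) (δ := δ) M₀) (t - μ.degree)

/-- The fibre monomial `R_μ` of degree `t`. [folklore] -/
def fibForm (t : ℕ) (μ : fibIdx Fy Fs →₀ ℕ) : MvPolynomial (Option β × ThetaIdx γ δ) ℂ :=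
  monomial (fibExpo M₀ Fy Fs t μ) 1

omit [Fintype β] [Fintype γ] [Fintype δ] [DecidableEq γ] in
/-- `R_μ` is a form of degree `t`. [folklore] -/
theorem isHomogeneous_fibForm {t : ℕ} {μ : fibIdx Fy Fs →₀ ℕ} (hμ : μ.degree ≤ t) :
    (fibForm M₀ Fy Fs t μ).IsHomogeneous t := by
  refine isHomogeneous_monomial _ ?_
  rw [fibExpo, map_add, Finsupp.degree_mapDomain, Finsupp.degree_single]
  omega

/-- The function `fibFun ν μ y s = ∏_j e^{μ_j y_j} · ∏_e (ν_e + s_e)^{μ_e}`. [folklore] -/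
def fibFun (ν : δ → ℂ) (μ : fibIdx Fy Fs →₀ ℕ) (y : β → ℂ) (s : δ → ℂ) : ℂ :=
  (∏ j : Fy, cexp (y j) ^ μ (Sum.inl j)) * ∏ e : Fs, (ν e + s e) ^ μ (Sum.inr e)

/-- The normalised fibre coordinates `ν_e(x) = Θ_{(M₀,e)}(x) / Θ₀(x)`. [folklore] -/
def fibNu (x : β ⊕ (γ ⊕ δ) → ℂ) : δ → ℂ := fun e => thetaPsome L κM M₀ e x / thetaPnone (β := β) (δ := δ) L M₀ x

omit [Fintype β] [Fintype δ] [DecidableEq γ] in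
/-- `Θ_{(M,none)}` only sees the `E`-coordinates. [folklore] -/
theorem thetaPnone_add_coords (x : β ⊕ (γ ⊕ δ) → ℂ) (y : β → ℂ) (s : δ → ℂ) :
    thetaPnone (β := β) (δ := δ) L M₀ (x + coords y 0 s) = thetaPnone (β := β) (δ := δ) L M₀ x := by
  unfold thetaPnone
  refine Finset.prod_congr rfl fun b _ => ?_
  simp

omit [Fintype β] [Fintype δ] in
/-- `Θ_{(M,e)}` is affine in `s_e` along translates with vanishing `E`-coordinates. [folklore] -/
theorem thetaPsome_add_coords (x : β ⊕ (γ ⊕ δ) → ℂ) (y : β → ℂ) (s : δ → ℂ) (e : δ) :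
    thetaPsome L κM M₀ e (x + coords y 0 s) = thetaPsome L κM M₀ e x + s e * thetaPnone (β := β) (δ := δ) L M₀ x := by
  rw [thetaPsome, thetaPsome, thetaPnone_add_coords]
  have hz : ∀ b, (x + coords y 0 s : β ⊕ (γ ⊕ δ) → ℂ) (iz b) = x (iz b) := fun b => by simp
  simp only [hz]
  have hs : (x + coords y 0 s : β ⊕ (γ ⊕ δ) → ℂ) (is e) = x (is e) + s e := by simp
  rw [hs]
  ring

omit [Fintype β] [Fintype δ] in
/-- **Factorisation of the fibre monomials along `(y, 0, s)`-translates.** [folklore] -/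
theorem thetaEval_fibForm_add {t : ℕ} {μ : fibIdx Fy Fs →₀ ℕ} (hμ : μ.degree ≤ t)
    {x : β ⊕ (γ ⊕ δ) → ℂ} (hx : thetaPnone (β := β) (δ := δ) L M₀ x ≠ 0) (y : β → ℂ) (s : δ → ℂ) :
    thetaEval L κM (fibForm M₀ Fy Fs t μ) (x + coords y 0 s) =
      thetaPnone (β := β) (δ := δ) L M₀ x ^ t * (∏ j : Fy, cexp (x (iy j)) ^ μ (Sum.inl j)) *
        fibFun Fy Fs (fibNu L κM M₀ x) μ y s := by
  set w' := x + coords y 0 s with hw'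
  set Θ := thetaPnone (β := β) (δ := δ) L M₀ x with hΘdef
  have h0 : ∀ J : Option β × ThetaIdx γ δ, (fun (J : Option β × ThetaIdx γ δ) (e : ℕ) => theta L κM J w' ^ e) J 0 = 1 :=
    fun J => pow_zero _
  have hadd : ∀ (J : Option β × ThetaIdx γ δ) (e₁ e₂ : ℕ),
      (fun (J : Option β × ThetaIdx γ δ) (e : ℕ) => theta L κM J w' ^ e) J (e₁ + e₂) =
        (fun (J : Option β × ThetaIdx γ δ) (e : ℕ) => theta L κM J w' ^ e) J e₁ *
          (fun (J : Option β × ThetaIdx γ δ) (e : ℕ) => theta L κM J w' ^ e) J e₂ :=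
    fun J e₁ e₂ => pow_add _ _ _
  rw [fibForm, thetaEval, eval_monomial, one_mul, fibExpo, Finsupp.prod_add_index' h0 hadd,
    Finsupp.prod_mapDomain_index h0 hadd]
  rw [Finsupp.prod_single_index (h := fun J e => theta L κM J w' ^ e) (pow_zero _),
    Finsupp.prod_fintype _ _ (fun i => pow_zero _)]
  -- the values of the variables at `w'`
  have hJ₀ : theta L κM (fibJ₀ (β := β) (δ := δ) M₀) w' = Θ := by
    simp [fibJ₀, theta, hw', thetaPnone_add_coords, hΘdef]
  have hinl : ∀ j : Fy, theta L κM (fibVar M₀ Fy Fs (Sum.inl j)) w' = cexp (x (iy j)) * cexp (y j) * Θ := by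
    intro j
    simp only [fibVar, theta, thetaT_some, thetaP_none, hw', thetaPnone_add_coords, ← hΘdef]
    have : (x + coords y 0 s : β ⊕ (γ ⊕ δ) → ℂ) (iy (j : β)) = x (iy j) + y j := by simp
    rw [this, exp_add]
  have hinr : ∀ e : Fs, theta L κM (fibVar M₀ Fy Fs (Sum.inr e)) w' = (fibNu L κM M₀ x e + s e) * Θ := by
    intro e
    simp only [fibVar, theta, thetaT_none, thetaP_some, one_mul, hw', thetaPsome_add_coords, fibNu, ← hΘdef]
    field_simp
  rw [Fintype.prod_sum_type]
  simp only [hJ₀, hinl, hinr, mul_pow, Finset.prod_mul_distrib, Finset.prod_pow_eq_pow_sum, fibFun]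
  have hdeg : (∑ j : Fy, μ (Sum.inl j)) + ∑ e : Fs, μ (Sum.inr e) = μ.degree := by
    rw [Finsupp.degree_eq_sum, Fintype.sum_sum_type]
  have key : Θ ^ (t - μ.degree) * (Θ ^ (∑ j : Fy, μ (Sum.inl j)) * Θ ^ (∑ e : Fs, μ (Sum.inr e))) = Θ ^ t := by
    rw [← pow_add, ← pow_add, hdeg, Nat.sub_add_cancel hμ]
  linear_combination ((∏ j : Fy, cexp (x (iy j)) ^ μ (Sum.inl j)) * (∏ j : Fy, cexp (y j) ^ μ (Sum.inl j)) *
    ∏ e : Fs, (fibNu L κM M₀ x e + s e) ^ μ (Sum.inr e)) * key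

/-! ### Independence of the functions `fibFun ν μ` -/

/-- The character `τ ↦ e^{⟨a, τ⟩}` of `ℂ^{F_y}` attached to `a ∈ ℕ^{F_y}`. [folklore] -/
def fibChar (a : Fy → ℕ) : Multiplicative (Fy → ℂ) →* ℂ where
  toFun τ := cexp (∑ j, (a j : ℂ) * (Multiplicative.toAdd τ) j)
  map_one' := by simp
  map_mul' τ τ' := by
    rw [← exp_add, ← Finset.sum_add_distrib]
    congr 1
    refine Finset.sum_congr rfl fun j _ => ?_
    simp only [toAdd_mul, Pi.add_apply]
    ring

omit [Fintype β] [Fintype γ] [Fintype δ] [DecidableEq γ] in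
/-- Unfolding `fibChar`. [folklore] -/
@[simp] theorem fibChar_apply (a : Fy → ℕ) (τ : Multiplicative (Fy → ℂ)) :
    fibChar Fy a τ = cexp (∑ j, (a j : ℂ) * (Multiplicative.toAdd τ) j) := rfl

omit [Fintype β] [Fintype γ] [Fintype δ] [DecidableEq γ] in
/-- Distinct exponents give distinct characters. [folklore] -/
theorem fibChar_injective : Function.Injective (fibChar (β := β) Fy) := by
  classical
  intro a a' h
  funext j
  by_contra hne
  set k : ℤ := (a j : ℤ) - a' j with hk
  have hk0 : k ≠ 0 := by
    have : (a j : ℤ) ≠ (a' j : ℤ) := by exact_mod_cast hne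
    omega
  have hkC : (k : ℂ) ≠ 0 := by exact_mod_cast hk0
  -- evaluate at `τ = (iπ / k) e_j`
  set c : ℂ := Real.pi * I / (k : ℂ) with hc
  have := DFunLike.congr_fun h (Multiplicative.ofAdd (Pi.single j c))
  simp only [fibChar_apply, toAdd_ofAdd] at this
  have hsum : ∀ a'' : Fy → ℕ, ∑ j', (a'' j' : ℂ) * (Pi.single j c : Fy → ℂ) j' = a'' j * c := by
    intro a''
    rw [Finset.sum_eq_single j (fun j' _ hj' => by simp [Pi.single_eq_of_ne hj']) (by simp)]
    simp
  rw [hsum, hsum] at this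
  have hquot : cexp ((a j : ℂ) * c - (a' j : ℂ) * c) = 1 := by
    rw [exp_sub, this, div_self (exp_ne_zero _)]
  have harg : (a j : ℂ) * c - (a' j : ℂ) * c = Real.pi * I := by
    have hkc : (k : ℂ) = (a j : ℂ) - (a' j : ℂ) := by rw [hk]; push_cast; ring
    rw [← sub_mul, ← hkc, hc, mul_div_cancel₀ _ hkC]
  rw [harg, exp_pi_mul_I] at hquot
  norm_num at hquot

omit [Fintype β] [Fintype δ] in
/-- **Linear independence of the fibre functions.** For subspaces `Y ≤ ℂ^β`, `S ≤ ℂ^δ` on which the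
coordinates `F_y`, `F_s` restrict SURJECTIVELY, a finite combination of the functions
`(y, s) ↦ fibFun ν μ y s` (distinct `μ`) vanishing on `Y × S` is trivial. [folklore] -/
theorem fibFun_linearIndependent (Y : Submodule ℂ (β → ℂ)) (S : Submodule ℂ (δ → ℂ))
    (hY : Function.Surjective fun y : Y => fun j : Fy => (y : β → ℂ) j)
    (hS : Function.Surjective fun s : S => fun e : Fs => (s : δ → ℂ) e)
    (ν : δ → ℂ) (T : Finset (fibIdx Fy Fs →₀ ℕ)) (c : (fibIdx Fy Fs →₀ ℕ) → ℂ)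
    (hc : ∀ y ∈ Y, ∀ s ∈ S, ∑ μ ∈ T, c μ * fibFun Fy Fs ν μ y s = 0) :
    ∀ μ ∈ T, c μ = 0 := by
  classical
  -- split `μ = (a, b)`
  let ya : (fibIdx Fy Fs →₀ ℕ) → (Fy → ℕ) := fun μ j => μ (Sum.inl j)
  let sb : (fibIdx Fy Fs →₀ ℕ) → (Fs →₀ ℕ) := fun μ => (Finsupp.sumFinsuppEquivProdFinsupp μ).2
  have hsb : ∀ μ (e : Fs), sb μ e = μ (Sum.inr e) := fun μ e => Finsupp.snd_sumFinsuppEquivProdFinsupp μ e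
  have hsplit : ∀ μ μ', ya μ = ya μ' → sb μ = sb μ' → μ = μ' := by
    intro μ μ' h1 h2
    ext i
    rcases i with j | e
    · exact congr_fun h1 j
    · rw [← hsb, ← hsb, h2]
  -- the functions in the free coordinates
  have hval : ∀ (τ : Fy → ℂ) (σ : Fs → ℂ),
      ∑ μ ∈ T, c μ * ((∏ j : Fy, cexp (τ j) ^ μ (Sum.inl j)) * ∏ e : Fs, (ν e + σ e) ^ μ (Sum.inr e)) = 0 := by
    intro τ σ
    obtain ⟨y, hy⟩ := hY τ
    obtain ⟨s, hs⟩ := hS σ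
    have := hc y y.2 s s.2
    simp only [fibFun] at this
    convert this using 2
    rename_i μ _
    simp only [← hy, ← hs]
  -- Step 1: group by the character `a = ya μ` and use the independence of characters
  have hchar : ∀ (σ : Fs → ℂ) (a : Fy → ℕ),
      ∑ μ ∈ T with ya μ = a, c μ * ∏ e : Fs, (ν e + σ e) ^ μ (Sum.inr e) = 0 := by
    intro σ a
    set A := T.image ya with hA
    set d : (Fy → ℕ) → ℂ := fun a' => ∑ μ ∈ T with ya μ = a', c μ * ∏ e : Fs, (ν e + σ e) ^ μ (Sum.inr e) with hd
    -- `∑_{a' ∈ A} d a' • fibChar a' = 0`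
    have hrel : ∑ a' ∈ A, d a' • ((fun f : Multiplicative (Fy → ℂ) →* ℂ => (f : Multiplicative (Fy → ℂ) → ℂ)) ∘
        fibChar Fy) a' = 0 := by
      funext τ
      simp only [Function.comp, Finset.sum_apply, Pi.smul_apply, smul_eq_mul, Pi.zero_apply, fibChar_apply]
      have h := hval (Multiplicative.toAdd τ) σ
      rw [← h, hA, ← Finset.sum_fiberwise_of_maps_to (s := T) (t := T.image ya) (g := ya)
        (fun μ hμ => Finset.mem_image_of_mem _ hμ)]
      refine Finset.sum_congr rfl fun a' _ => ?_
      rw [hd, Finset.sum_mul]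
      refine Finset.sum_congr rfl fun μ hμ => ?_
      rw [Finset.mem_filter] at hμ
      have hexp : cexp (∑ j, (a' j : ℂ) * (Multiplicative.toAdd τ) j) = ∏ j : Fy, cexp ((Multiplicative.toAdd τ) j) ^ μ (Sum.inl j) := by
        rw [exp_sum]
        refine Finset.prod_congr rfl fun j _ => ?_
        rw [← exp_nat_mul, ← hμ.2]
      rw [hexp]
      ring
    -- independence of distinct characters
    have hli := (linearIndependent_monoidHom (Multiplicative (Fy → ℂ)) ℂ).comp (fibChar Fy) (fibChar_injective Fy)
    rw [linearIndependent_iff'] at hli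
    have hd0 := hli A d hrel
    by_cases haA : a ∈ A
    · exact hd0 a haA
    · -- no `μ` with `ya μ = a`
      refine Finset.sum_eq_zero fun μ hμ => ?_
      rw [Finset.mem_filter] at hμ
      exact absurd (Finset.mem_image.mpr ⟨μ, hμ.1, hμ.2⟩) haA
  -- Step 2: for fixed `a`, a polynomial identity in `σ`
  intro μ₀ hμ₀
  have hpoly : ∀ a : Fy → ℕ,
      (aeval fun e : Fs => X e + C (ν e)) (∑ μ ∈ T with ya μ = a, c μ • monomial (sb μ) (1 : ℂ)) = 0 := by
    intro a
    apply MvPolynomial.funext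
    intro σ
    rw [map_zero, map_sum, map_sum, ← hchar σ a]
    refine Finset.sum_congr rfl fun μ _ => ?_
    rw [map_smul, smul_eval, aeval_monomial, map_one, one_mul]
    congr 1
    rw [Finsupp.prod_fintype _ _ (fun e => pow_zero _), map_prod]
    refine Finset.prod_congr rfl fun e _ => ?_
    rw [map_pow, hsb]
    simp [add_comm]
  -- the shift `s ↦ s + ν` is injective on `ℂ[s]`
  have hinjsh : Function.Injective (aeval fun e : Fs => X e + C (ν e) : MvPolynomial Fs ℂ →ₐ[ℂ] MvPolynomial Fs ℂ) := by
    have hcomp : (aeval fun e : Fs => X e - C (ν e) : MvPolynomial Fs ℂ →ₐ[ℂ] MvPolynomial Fs ℂ).comp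
        (aeval fun e : Fs => X e + C (ν e)) = AlgHom.id ℂ _ := by
      refine algHom_ext fun e => ?_
      simp
    intro q q' h
    have := DFunLike.congr_fun hcomp q
    have h' := DFunLike.congr_fun hcomp q'
    simp only [AlgHom.comp_apply, AlgHom.id_apply] at this h'
    rw [← this, ← h', h]
  have hp0 : ∑ μ ∈ T with ya μ = ya μ₀, c μ • monomial (sb μ) (1 : ℂ) = 0 :=
    hinjsh (by rw [hpoly, map_zero])
  -- extract the coefficient of `sb μ₀`
  have hcoeff := congr_arg (coeff (sb μ₀)) hp0
  rw [coeff_zero, coeff_sum] at hcoeff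
  have hsingle : ∑ μ ∈ T with ya μ = ya μ₀, coeff (sb μ₀) (c μ • monomial (sb μ) (1 : ℂ)) = c μ₀ := by
    have hmem : μ₀ ∈ T.filter (fun μ => ya μ = ya μ₀) := Finset.mem_filter.mpr ⟨hμ₀, rfl⟩
    rw [Finset.sum_eq_single_of_mem μ₀ hmem]
    · rw [coeff_smul, coeff_monomial, if_pos rfl, smul_eq_mul, mul_one]
    · intro μ hμ hne
      rw [Finset.mem_filter] at hμ
      rw [coeff_smul, coeff_monomial, if_neg, smul_zero]
      intro h
      exact hne (hsplit μ μ₀ hμ.2 h)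
  rw [hsingle] at hcoeff
  exact hcoeff

end Std

end GaGmE

end Literature.NumberTheory.Transcendental

end
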